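import Summits.QuantumFields.QCD.Theses.CounterexampleMustBeHot
import Literature.MathematicalPhysics.QuantumFieldTheory.QCDThermalPartition

/-!
# Line `massive-gas` — skeleton for the piece `GapImpliesCold` (stmt-QuantumFields-18760) of the
# decomposition of `ChiralColdCertificate` (stmt-QuantumFields-17303), crux-strategist r1

`GapImpliesCold`: a volume-uniform full-spectrum lattice gap `ε` along `reg.scheme m` forces the
infinite-volume thermal d.o.f. count `F_k(⌈1/(a_k T)⌉) ≤ θ` at every `T ≤ c(reg, θ)·ε`, eventually in `k`.

Stubs:
* `stub_massiveGasLaw` — THE PHYSICS (load-bearing, open): under a uniform gap `ε` the thermal free-energy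
  deficit obeys the dilute-massive-gas law UNIFORMLY in the cutoff and in the mass tuple:
  `e₀(k) − φ_k(N_t) ≤ A (εa_k)⁴ x^q e^{−x}`, `x = ε a_k N_t ≥ 1` (`x = ε/T`), with `A, q` depending on
  `reg` only — a bound on the low-energy entropy density / near-gap species count, which a gap on the
  time-decay of fixed local observables does not give by itself (Gerber–Leutwyler's hadron gas is the
  expected truth: `p/T⁴ = Σ_species g (M/2πT)^{3/2} e^{−M/T}`, `M ≥ ε`).
* `stub_coldFromMassiveGasLaw` — CALCULUS + BOOKKEEPING (provable now, M): `x^{q+4} e^{−x} → 0`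
  (`Real.tendsto_pow_mul_exp_neg_atTop_nhds_zero`) gives `c = c(A, q, θ)`; and `T ≤ cε`,
  `N_t = ⌈1/(aT)⌉` give `x = ε a N_t ≥ ε/T ≥ 1/c ≥ 1` and `(90/π²) N_t⁴ · A(εa)⁴x^q e^{−x} = (90/π²) A x^{q+4} e^{−x} ≤ θ`.
-/

noncomputable section

namespace Summit.QuantumFields.QCD.Cruxes.ChiralColdCertificate.MassiveGas

open scoped Topology
open Filter Literature.MathematicalPhysics.QuantumFieldTheory
/-! ### Vocabulary over the Literature definition `thermalFreeEnergyDensity` (definitionally the route's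
inlined `let f`, checked by `Iff.rfl` below) -/

/-- the thermodynamic (`N_s → ∞` at fixed `N_t`, shifted index `N_s + 1`) and zero-temperature (`N_t → ∞`)
limits of the thermal free energy per site along the scheme: the route's `Lim`. -/
def ThermoLim (Nf : ℕ) (sch : QCDScheme Nf) (φ : ℕ → ℕ → ℝ) (e₀ : ℕ → ℝ) : Prop :=
  (∀ (k Nt : ℕ) [NeZero Nt], Tendsto
      (fun Ns : ℕ => thermalFreeEnergyDensity Nf Nt (Ns + 1) (sch.β k) (fun fl => sch.mq fl k))
      atTop (𝓝 (φ k Nt))) ∧ ∀ k : ℕ, Tendsto (φ k) atTop (𝓝 (e₀ k))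

/-- the thermal degree-of-freedom count `F_k(N_t) = (90/π²) N_t⁴ (e₀(k) − φ_k(N_t))` (route's `F`). -/
def dof (φ : ℕ → ℕ → ℝ) (e₀ : ℕ → ℝ) (k Nt : ℕ) : ℝ :=
  90 / Real.pi ^ 2 * (Nt : ℝ) ^ 4 * (e₀ k - φ k Nt)

/-- its finite-volume twin `F^fin_k(N_t, N_s)` (route's `Ffin`). -/
def dofFin (Nf : ℕ) (sch : QCDScheme Nf) (e₀ : ℕ → ℝ) (k Nt Ns : ℕ) [NeZero Nt] [NeZero Ns] : ℝ :=
  90 / Real.pi ^ 2 * (Nt : ℝ) ^ 4 *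
    (e₀ k - thermalFreeEnergyDensity Nf Nt Ns (sch.β k) (fun fl => sch.mq fl k))

/-- the one-temperature, aspect-`≥ 1` cold certificate (route's `ColdFin`). -/
def ColdFinAt (Nf : ℕ) (sch : QCDScheme Nf) (e₀ : ℕ → ℝ) (η T₁ : ℝ) : Prop :=
  ∀ᶠ k in atTop, ∀ (Nt : ℕ) [NeZero Nt], Nt = ⌈(sch.a k * T₁)⁻¹⌉₊ →
    ∀ (Ns : ℕ) [NeZero Ns], Nt ≤ Ns → dofFin Nf sch e₀ k Nt Ns ≤ η


/-- `GapImpliesCold` in this vocabulary. -/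
def GapImpliesColdLit : Prop :=
  ∀ Nf : ℕ, Nf = 2 ∨ Nf = 3 → ∀ reg : QCDRegularisation Nf, reg.HasMassScaling →
    (reg.scheme 0 0 0).HasAsymptoticScaling → ∀ θ : ℝ, 0 < θ → ∃ c : ℝ, 0 < c ∧ ∀ m : Fin Nf → ℝ,
    (∀ fl, 0 < m fl) → (∀ fl : Fin Nf, ∀ᶠ k in atTop, -1 < (reg.scheme m 0 0).mq fl k) → ∀ ε : ℝ, 0 < ε →
    (reg.scheme m 0 0).HasLatticeMassGap ε → ∀ (φ : ℕ → ℕ → ℝ) (e₀ : ℕ → ℝ),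
    ThermoLim Nf (reg.scheme m 0 0) φ e₀ → ∀ T : ℝ, 0 < T → T ≤ c * ε →
    ∀ᶠ k in atTop, dof φ e₀ k ⌈((reg.scheme m 0 0).a k * T)⁻¹⌉₊ ≤ θ

/-- STUB 1 — the dilute-massive-gas law under a uniform lattice gap, uniformly in the cutoff and in the
mass tuple (Gerber–Leutwyler 1989 for the expected form; Lüscher 1977/1986 for the transfer-matrix and
finite-volume inputs). OPEN. -/
theorem stub_massiveGasLaw : ∀ Nf : ℕ, Nf = 2 ∨ Nf = 3 → ∀ reg : QCDRegularisation Nf, reg.HasMassScaling →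
      (reg.scheme 0 0 0).HasAsymptoticScaling → ∃ A : ℝ, 0 < A ∧ ∃ q : ℕ, ∀ m : Fin Nf → ℝ, (∀ fl, 0 < m fl) →
      (∀ fl : Fin Nf, ∀ᶠ k in atTop, -1 < (reg.scheme m 0 0).mq fl k) → ∀ ε : ℝ, 0 < ε →
      (reg.scheme m 0 0).HasLatticeMassGap ε → ∀ (φ : ℕ → ℕ → ℝ) (e₀ : ℕ → ℝ), ThermoLim Nf (reg.scheme m 0 0) φ e₀ →
      ∀ᶠ k in atTop, ∀ Nt : ℕ, 1 ≤ ε * (reg.scheme m 0 0).a k * Nt →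
        e₀ k - φ k Nt ≤ A * (ε * (reg.scheme m 0 0).a k) ^ 4 * (ε * (reg.scheme m 0 0).a k * Nt) ^ q *
          Real.exp (-(ε * (reg.scheme m 0 0).a k * Nt)) := by
  sorry

/-- STUB 2 — calculus and bookkeeping: `x^{q+4}e^{−x} → 0` fixes `c(A, q, θ)`, and `T ≤ cε`,
`N_t = ⌈1/(aT)⌉` put `x = εaN_t` beyond `1/c`. Provable now (`Real.tendsto_pow_mul_exp_neg_atTop_nhds_zero`,
`Nat.le_ceil`). -/
theorem stub_coldFromMassiveGasLaw : ∀ (A : ℝ) (q : ℕ) (θ : ℝ), 0 < A → 0 < θ → ∃ c : ℝ, 0 < c ∧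
      ∀ (ε a T : ℝ) (Nt : ℕ), 0 < ε → 0 < a → 0 < T → T ≤ c * ε → Nt = ⌈(a * T)⁻¹⌉₊ →
        1 ≤ ε * a * Nt ∧ ∀ d : ℝ, d ≤ A * (ε * a) ^ 4 * (ε * a * Nt) ^ q * Real.exp (-(ε * a * Nt)) →
          90 / Real.pi ^ 2 * (Nt : ℝ) ^ 4 * d ≤ θ := by
  sorry

/-- Composition in this vocabulary. -/
theorem gapImpliesColdLit_of_stubs
    (h₁ : ∀ Nf : ℕ, Nf = 2 ∨ Nf = 3 → ∀ reg : QCDRegularisation Nf, reg.HasMassScaling →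
      (reg.scheme 0 0 0).HasAsymptoticScaling → ∃ A : ℝ, 0 < A ∧ ∃ q : ℕ, ∀ m : Fin Nf → ℝ, (∀ fl, 0 < m fl) →
      (∀ fl : Fin Nf, ∀ᶠ k in atTop, -1 < (reg.scheme m 0 0).mq fl k) → ∀ ε : ℝ, 0 < ε →
      (reg.scheme m 0 0).HasLatticeMassGap ε → ∀ (φ : ℕ → ℕ → ℝ) (e₀ : ℕ → ℝ), ThermoLim Nf (reg.scheme m 0 0) φ e₀ →
      ∀ᶠ k in atTop, ∀ Nt : ℕ, 1 ≤ ε * (reg.scheme m 0 0).a k * Nt →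
        e₀ k - φ k Nt ≤ A * (ε * (reg.scheme m 0 0).a k) ^ 4 * (ε * (reg.scheme m 0 0).a k * Nt) ^ q *
          Real.exp (-(ε * (reg.scheme m 0 0).a k * Nt)))
    (h₂ : ∀ (A : ℝ) (q : ℕ) (θ : ℝ), 0 < A → 0 < θ → ∃ c : ℝ, 0 < c ∧
      ∀ (ε a T : ℝ) (Nt : ℕ), 0 < ε → 0 < a → 0 < T → T ≤ c * ε → Nt = ⌈(a * T)⁻¹⌉₊ →
        1 ≤ ε * a * Nt ∧ ∀ d : ℝ, d ≤ A * (ε * a) ^ 4 * (ε * a * Nt) ^ q * Real.exp (-(ε * a * Nt)) →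
          90 / Real.pi ^ 2 * (Nt : ℝ) ^ 4 * d ≤ θ) :
    GapImpliesColdLit := by
  intro Nf hNf reg hms has θ hθ
  obtain ⟨A, hA, q, hlaw⟩ := h₁ Nf hNf reg hms has
  obtain ⟨c, hc, hcal⟩ := h₂ A q θ hA hθ
  refine ⟨c, hc, fun m hm hbr ε hε hgap φ e₀ hlim T hT hTc => ?_⟩
  filter_upwards [hlaw m hm hbr ε hε hgap φ e₀ hlim] with k hk
  obtain ⟨hx, hbound⟩ := hcal ε ((reg.scheme m 0 0).a k) T _ hε ((reg.scheme m 0 0).a_pos k) hT hTc rfl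
  exact hbound _ (hk _ hx)

/-- The piece is definitionally its Literature-vocabulary form. -/
theorem gapImpliesCold_iff_lit : Summit.QuantumFields.QCD.Theses.CounterexampleMustBeHot.GapImpliesCold ↔ GapImpliesColdLit :=
  Iff.rfl

/-- **Skeleton theorem — `GapImpliesCold` BY NAME from the registered stubs** (A12 shape: no hypotheses; the
only sorries of the file sit inside `stub_*`; once the stubs are proved this very theorem is the proof of
the piece). The sorry-free, kernel-checked composition with the stub statements as explicit hypotheses
is `gapImpliesColdLit_of_stubs` above (conclusion `GapImpliesColdLit`,
definitionally the route decl: `gapImpliesCold_iff_lit`). -/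
theorem GapImpliesCold_of :
    Summit.QuantumFields.QCD.Theses.CounterexampleMustBeHot.GapImpliesCold :=
  gapImpliesCold_iff_lit.mpr
    (gapImpliesColdLit_of_stubs stub_massiveGasLaw stub_coldFromMassiveGasLaw)

end Summit.QuantumFields.QCD.Cruxes.ChiralColdCertificate.MassiveGas

end
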